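import Mathlib
import Summits.NavierStokesRegularity.NavierStokesRegularity.Theorems.FilamentSkeletonRssSelectionBoxRJRungGradCurveLipschitz
import Summits.NavierStokesRegularity.NavierStokesRegularity.Theorems.FilamentSkeletonRssSelectionBoxRJRungPicardForcingLip

/-!
# Route `FilamentSkeletonRss` · crux `SelectionBoxRJ` (stmt-NavierStokesRegularity-21220) — rung tools (R2, brick 2c, tools):
# ingredients for the `C¹` closeness of the true partner forcing to the frozen one

Lane `ns-filament-19175-p1` (g7); helper file `--supports stmt-NavierStokesRegularity-21220`, route-independent.

* `nearStraight_sep_line_sqrt` — `‖z τ − ℓ₂ σ‖ ≥ (1 − θ)√(4Γ/25 + τ² + σ²)` for a near-straight curve `z` through `P`;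
* `line_sep_sqrt` — `‖ℓ₁ τ − ℓ₂ σ‖ = √(4Γ/25 + τ² + σ²)`;
* `lineField_differentiable`, `lineField_translate_fderiv` — the straight partner's field `F₂` is differentiable, and the field of
  the TRANSLATED line `ℓ₂ + d` is `F₂ ∘ (· − d)`, so its derivative at `y` is `fderiv F₂ (y − d)`;
* `U_eq_lineField_comp`, `U_deriv_eq` — `U = (Γ·4/(4π)) • F₂ ∘ ℓ₁` and `deriv U t = (Γ·4/(4π)) • (fderiv F₂ (ℓ₁ t)) e`;
* numeric bounds `termD1_bound`, `termD2_bound`, `termD3_bound` (`≤ 356θ`, `≤ 303θ`, `≤ 50θ` after the factor `Γ·4/(4π)`).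

HONEST FRAMING.  Bookkeeping for the rung ladder of a HYPOTHETICAL filament box; nothing here is a claim about Navier–Stokes
regularity or blow-up.
-/

set_option linter.dupNamespace false -- `Theorems.…Theorems`-style path/namespace repetition is the tree convention

noncomputable section

namespace Summit.NavierStokesRegularity.NavierStokesRegularity.Theorems

open Set Function Filter MeasureTheory Real
open Literature.Analysis.FluidPDE
open Summit.NavierStokesRegularity.NavierStokesRegularity.Theorems.SkeletonEquilibrium.Sketch
open scoped InnerProductSpace Topology

namespace SelectionBoxRJRung

/-- `‖ℓ₁ τ − ℓ₂ σ‖ = √(4Γ/25 + τ² + σ²)` for the two straight lines of rung 0 (`Γ ≥ 0`). [folklore] -/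
theorem line_sep_sqrt (Γ τ σ : ℝ) (hΓ : 0 ≤ Γ) :
    ‖((WithLp.toLp 2 ![Real.sqrt Γ / 5, 0, 0] : EuclideanSpace ℝ (Fin 3)) +
        τ • WithLp.toLp 2 ![0, (Real.sqrt 2)⁻¹, (Real.sqrt 2)⁻¹]) -
      ((WithLp.toLp 2 ![-(Real.sqrt Γ / 5), 0, 0] : EuclideanSpace ℝ (Fin 3)) +
        σ • WithLp.toLp 2 ![0, -(Real.sqrt 2)⁻¹, (Real.sqrt 2)⁻¹])‖ = Real.sqrt (4 * Γ / 25 + τ ^ 2 + σ ^ 2) := by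
  have h := norm_sq_line_sub_rot Γ τ σ hΓ
  rw [rotPi_line] at h
  rw [← h, Real.sqrt_sq (norm_nonneg _)]

/-- **Near-straight curve versus the partner line, square-root form:** `‖z τ − ℓ₂ σ‖ ≥ (1 − θ)√(4Γ/25 + τ² + σ²)`
(`0 ≤ θ`). [folklore] -/
theorem nearStraight_sep_line_sqrt {Γ θ : ℝ} (hΓ : 0 < Γ) (hθ0 : 0 ≤ θ) {z : ℝ → EuclideanSpace ℝ (Fin 3)}
    (hzd : Differentiable ℝ z) (hz0 : z 0 = WithLp.toLp 2 ![Real.sqrt Γ / 5, 0, 0])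
    (hθ : ∀ s, ‖deriv z s - WithLp.toLp 2 ![0, (Real.sqrt 2)⁻¹, (Real.sqrt 2)⁻¹]‖ ≤ θ) (τ σ : ℝ) :
    (1 - θ) * Real.sqrt (4 * Γ / 25 + τ ^ 2 + σ ^ 2) ≤
      ‖z τ - ((WithLp.toLp 2 ![-(Real.sqrt Γ / 5), 0, 0] : EuclideanSpace ℝ (Fin 3)) +
        σ • WithLp.toLp 2 ![0, -(Real.sqrt 2)⁻¹, (Real.sqrt 2)⁻¹])‖ := by
  have hdτ := arc_displacement_le hzd hz0 hθ τ
  have hN := line_sep_sqrt Γ τ σ hΓ.le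
  set L := ((WithLp.toLp 2 ![-(Real.sqrt Γ / 5), 0, 0] : EuclideanSpace ℝ (Fin 3)) +
          σ • WithLp.toLp 2 ![0, -(Real.sqrt 2)⁻¹, (Real.sqrt 2)⁻¹]) with hLdef
  set ℓ := ((WithLp.toLp 2 ![Real.sqrt Γ / 5, 0, 0] : EuclideanSpace ℝ (Fin 3)) +
        τ • WithLp.toLp 2 ![0, (Real.sqrt 2)⁻¹, (Real.sqrt 2)⁻¹]) with hℓdef
  have hNτ : |τ| ≤ ‖ℓ - L‖ := by
    rw [hN, ← Real.sqrt_sq_eq_abs]; exact Real.sqrt_le_sqrt (by nlinarith only [hΓ, sq_nonneg σ])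
  have htri : ‖ℓ - L‖ - ‖z τ - ℓ‖ ≤ ‖z τ - L‖ := by
    have := norm_sub_le_norm_sub_add_norm_sub ℓ (z τ) L
    rw [norm_sub_rev ℓ (z τ)] at this; linarith only [this]
  have h1 := mul_le_mul_of_nonneg_left hNτ hθ0
  rw [← hN]
  linarith only [htri, hdτ, h1]

/-- **The straight partner's regularised Biot–Savart field is differentiable** (tree `stub_biotSavartDifferentiable` with the
line `ℓ₂`, core `1`, growth `|u|`). [folklore] -/
theorem lineField_differentiable (Γ : ℝ) (hΓ : 0 ≤ Γ) :
    Differentiable ℝ (fun y : EuclideanSpace ℝ (Fin 3) => ∫ u : ℝ,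
      ((‖y - ((WithLp.toLp 2 ![-(Real.sqrt Γ / 5), 0, 0] : EuclideanSpace ℝ (Fin 3)) +
          u • WithLp.toLp 2 ![0, -(Real.sqrt 2)⁻¹, (Real.sqrt 2)⁻¹])‖ ^ 2 + 1) ^ (3 / 2 : ℝ))⁻¹ •
        cross (deriv (fun u : ℝ => (WithLp.toLp 2 ![-(Real.sqrt Γ / 5), 0, 0] : EuclideanSpace ℝ (Fin 3)) +
          u • WithLp.toLp 2 ![0, -(Real.sqrt 2)⁻¹, (Real.sqrt 2)⁻¹]) u)
          (y - ((WithLp.toLp 2 ![-(Real.sqrt Γ / 5), 0, 0] : EuclideanSpace ℝ (Fin 3)) +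
            u • WithLp.toLp 2 ![0, -(Real.sqrt 2)⁻¹, (Real.sqrt 2)⁻¹]))) := by
  have hX : ContDiff ℝ 1 (fun u : ℝ => (WithLp.toLp 2 ![-(Real.sqrt Γ / 5), 0, 0] : EuclideanSpace ℝ (Fin 3)) +
      u • WithLp.toLp 2 ![0, -(Real.sqrt 2)⁻¹, (Real.sqrt 2)⁻¹]) := by fun_prop
  have hdX : ∀ u, ‖deriv (fun u : ℝ => (WithLp.toLp 2 ![-(Real.sqrt Γ / 5), 0, 0] : EuclideanSpace ℝ (Fin 3)) +
      u • WithLp.toLp 2 ![0, -(Real.sqrt 2)⁻¹, (Real.sqrt 2)⁻¹]) u‖ ≤ 1 := fun u => by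
    rw [deriv_line, norm_tangent₂]
  have hgrow : ∀ u, 1 * |u| - 0 ≤ ‖(WithLp.toLp 2 ![-(Real.sqrt Γ / 5), 0, 0] : EuclideanSpace ℝ (Fin 3)) +
      u • WithLp.toLp 2 ![0, -(Real.sqrt 2)⁻¹, (Real.sqrt 2)⁻¹]‖ := fun u => by
    have h2 := norm_sq_line₂ Γ u hΓ
    have hn := norm_nonneg ((WithLp.toLp 2 ![-(Real.sqrt Γ / 5), 0, 0] : EuclideanSpace ℝ (Fin 3)) +
      u • WithLp.toLp 2 ![0, -(Real.sqrt 2)⁻¹, (Real.sqrt 2)⁻¹])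
    rw [one_mul, sub_zero]
    nlinarith only [h2, hn, sq_abs u, abs_nonneg u, hΓ, mul_nonneg hn (abs_nonneg u)]
  have h := stub_biotSavartDifferentiable 1 1 0 _ one_ne_zero one_pos hX hdX hgrow
  simp only [one_pow] at h
  exact h

/-- **Translating the partner line translates its field:** for the line `u ↦ ℓ₂ u + d` the regularised Biot–Savart field at
`y` equals the field of `ℓ₂` at `y − d`; hence (`lineField_translate_fderiv`) their Fréchet derivatives agree:
`fderiv F[ℓ₂ + d] y = fderiv F[ℓ₂] (y − d)`. [folklore] -/
theorem lineField_translate_fderiv (Γ : ℝ) (hΓ : 0 ≤ Γ) (d y : EuclideanSpace ℝ (Fin 3)) :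
    fderiv ℝ (fun y : EuclideanSpace ℝ (Fin 3) => ∫ u : ℝ,
      ((‖y - ((WithLp.toLp 2 ![-(Real.sqrt Γ / 5), 0, 0] : EuclideanSpace ℝ (Fin 3)) +
          u • WithLp.toLp 2 ![0, -(Real.sqrt 2)⁻¹, (Real.sqrt 2)⁻¹] + d)‖ ^ 2 + 1) ^ (3 / 2 : ℝ))⁻¹ •
        cross (deriv (fun u : ℝ => (WithLp.toLp 2 ![-(Real.sqrt Γ / 5), 0, 0] : EuclideanSpace ℝ (Fin 3)) +
          u • WithLp.toLp 2 ![0, -(Real.sqrt 2)⁻¹, (Real.sqrt 2)⁻¹] + d) u)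
          (y - ((WithLp.toLp 2 ![-(Real.sqrt Γ / 5), 0, 0] : EuclideanSpace ℝ (Fin 3)) +
            u • WithLp.toLp 2 ![0, -(Real.sqrt 2)⁻¹, (Real.sqrt 2)⁻¹] + d))) y =
    fderiv ℝ (fun y : EuclideanSpace ℝ (Fin 3) => ∫ u : ℝ,
      ((‖y - ((WithLp.toLp 2 ![-(Real.sqrt Γ / 5), 0, 0] : EuclideanSpace ℝ (Fin 3)) +
          u • WithLp.toLp 2 ![0, -(Real.sqrt 2)⁻¹, (Real.sqrt 2)⁻¹])‖ ^ 2 + 1) ^ (3 / 2 : ℝ))⁻¹ •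
        cross (deriv (fun u : ℝ => (WithLp.toLp 2 ![-(Real.sqrt Γ / 5), 0, 0] : EuclideanSpace ℝ (Fin 3)) +
          u • WithLp.toLp 2 ![0, -(Real.sqrt 2)⁻¹, (Real.sqrt 2)⁻¹]) u)
          (y - ((WithLp.toLp 2 ![-(Real.sqrt Γ / 5), 0, 0] : EuclideanSpace ℝ (Fin 3)) +
            u • WithLp.toLp 2 ![0, -(Real.sqrt 2)⁻¹, (Real.sqrt 2)⁻¹]))) (y - d) := by
  set Q : EuclideanSpace ℝ (Fin 3) := WithLp.toLp 2 ![-(Real.sqrt Γ / 5), 0, 0] with hQ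
  set e₂ : EuclideanSpace ℝ (Fin 3) := WithLp.toLp 2 ![0, -(Real.sqrt 2)⁻¹, (Real.sqrt 2)⁻¹] with he₂
  set F₂ : EuclideanSpace ℝ (Fin 3) → EuclideanSpace ℝ (Fin 3) := fun y => ∫ u : ℝ,
      ((‖y - (Q + u • e₂)‖ ^ 2 + 1) ^ (3 / 2 : ℝ))⁻¹ • cross (deriv (fun u : ℝ => Q + u • e₂) u) (y - (Q + u • e₂))
    with hF₂
  have hd1 : ∀ u, deriv (fun u : ℝ => Q + u • e₂ + d) u = e₂ := fun u => by
    have : (fun u : ℝ => Q + u • e₂ + d) = fun u : ℝ => (Q + d) + u • e₂ := by funext u; abel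
    rw [this, deriv_line]
  have hd2 : ∀ u, deriv (fun u : ℝ => Q + u • e₂) u = e₂ := fun u => by rw [deriv_line]
  have hfun : (fun y : EuclideanSpace ℝ (Fin 3) => ∫ u : ℝ,
      ((‖y - (Q + u • e₂ + d)‖ ^ 2 + 1) ^ (3 / 2 : ℝ))⁻¹ • cross (deriv (fun u : ℝ => Q + u • e₂ + d) u)
        (y - (Q + u • e₂ + d))) = fun y => F₂ (y - d) := by
    funext y
    simp only [hF₂, hd1, hd2]
    congr 1
    funext u
    rw [show y - (Q + u • e₂ + d) = y - d - (Q + u • e₂) by abel]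
  rw [hfun]
  have hF₂d : Differentiable ℝ F₂ := by rw [hF₂, hQ, he₂]; exact lineField_differentiable Γ hΓ
  have h := ((hF₂d (y - d)).hasFDerivAt).comp y ((hasFDerivAt_id y).sub_const d)
  rw [ContinuousLinearMap.comp_id] at h
  exact h.fderiv

/-- Numeric bound, Term D1 (curve change of the gradient seen from `z t`): with `c = 1 − 2θ`, `D = c(2/5)√Γ`,
`(Γ/π)·2πD(4θ + 24θD/(cD))/(cD³) ≤ 356θ` for `0 ≤ θ ≤ 1/500`. [folklore] -/
theorem termD1_bound {Γ θ : ℝ} (hΓ : 0 < Γ) (hθ0 : 0 ≤ θ) (hθ1 : θ ≤ 1 / 500) :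
    Γ * 4 / (4 * Real.pi) * (2 * Real.pi * ((1 - 2 * θ) * (2 * Real.sqrt Γ / 5) + 0) *
      (4 * θ + 24 * θ * ((1 - 2 * θ) * (2 * Real.sqrt Γ / 5) + 0) / ((1 - 2 * θ) * ((1 - 2 * θ) * (2 * Real.sqrt Γ / 5)))
        + 24 * 0 / ((1 - 2 * θ) * (2 * Real.sqrt Γ / 5))) /
      ((1 - 2 * θ) * ((1 - 2 * θ) * (2 * Real.sqrt Γ / 5)) ^ 3)) ≤ 356 * θ := by
  have hG : 0 < Real.sqrt Γ := Real.sqrt_pos.2 hΓ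
  have hG2 : Real.sqrt Γ ^ 2 = Γ := Real.sq_sqrt hΓ.le
  have hc : 0 < 1 - 2 * θ := by linarith
  have heq : Γ * 4 / (4 * Real.pi) * (2 * Real.pi * ((1 - 2 * θ) * (2 * Real.sqrt Γ / 5) + 0) *
      (4 * θ + 24 * θ * ((1 - 2 * θ) * (2 * Real.sqrt Γ / 5) + 0) / ((1 - 2 * θ) * ((1 - 2 * θ) * (2 * Real.sqrt Γ / 5)))
        + 24 * 0 / ((1 - 2 * θ) * (2 * Real.sqrt Γ / 5))) /
      ((1 - 2 * θ) * ((1 - 2 * θ) * (2 * Real.sqrt Γ / 5)) ^ 3)) =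
      25 / 2 * θ * (4 * (1 - 2 * θ) + 24) / (1 - 2 * θ) ^ 4 := by
    have hcne : (1 - 2 * θ) ≠ 0 := hc.ne'
    have hπ : Real.pi ≠ 0 := Real.pi_pos.ne'
    generalize hGdef : Real.sqrt Γ = G at hG hG2 ⊢
    subst hG2
    have hG0 : G ≠ 0 := hG.ne'
    field_simp
    ring
  rw [heq, div_le_iff₀ (pow_pos hc 4)]
  have hc4 : (249 / 250 : ℝ) ^ 4 ≤ (1 - 2 * θ) ^ 4 := pow_le_pow_left₀ (by norm_num) (by linarith) 4
  nlinarith [hc4, mul_nonneg hθ0 (sub_nonneg.2 hc4)]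

/-- Numeric bound, Term D2 (translation of the line by `θ|t|`, seen from `ℓ₁ t`): with `c = 1 − θ`, `D = c N₁`,
`N₁² = 4Γ/25 + t²`: `(Γ/π)·2πD(24θ|t|/D)/(cD³) ≤ 303θ` (uses `|t| ≤ N₁`). [folklore] -/
theorem termD2_bound {Γ θ t N : ℝ} (hΓ : 0 < Γ) (hθ0 : 0 ≤ θ) (hθ1 : θ ≤ 1 / 500) (hN : N ^ 2 = 4 * Γ / 25 + t ^ 2)
    (hN0 : 0 ≤ N) :
    Γ * 4 / (4 * Real.pi) * (2 * Real.pi * ((1 - θ) * N + 0) *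
      (4 * 0 + 24 * 0 * ((1 - θ) * N + 0) / ((1 - θ) * ((1 - θ) * N)) + 24 * (θ * |t|) / ((1 - θ) * N)) /
      ((1 - θ) * ((1 - θ) * N) ^ 3)) ≤ 303 * θ := by
  have hNpos : 0 < N := by nlinarith [sq_nonneg t]
  have hc : 0 < 1 - θ := by linarith
  have htN : |t| ≤ N := by nlinarith [sq_abs t, abs_nonneg t, hΓ, mul_nonneg hN0 (abs_nonneg t)]
  have heq : Γ * 4 / (4 * Real.pi) * (2 * Real.pi * ((1 - θ) * N + 0) *
      (4 * 0 + 24 * 0 * ((1 - θ) * N + 0) / ((1 - θ) * ((1 - θ) * N)) + 24 * (θ * |t|) / ((1 - θ) * N)) /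
      ((1 - θ) * ((1 - θ) * N) ^ 3)) = 48 * Γ * θ * |t| / ((1 - θ) ^ 4 * N ^ 3) := by
    have hcne : (1 - θ) ≠ 0 := hc.ne'
    have hπ : Real.pi ≠ 0 := Real.pi_pos.ne'
    have hNne : N ≠ 0 := hNpos.ne'
    field_simp
    ring
  rw [heq, div_le_iff₀ (by positivity)]
  have hc4 : (499 / 500 : ℝ) ^ 4 ≤ (1 - θ) ^ 4 := pow_le_pow_left₀ (by norm_num) (by linarith) 4
  -- `48 Γ θ |t| ≤ 303 θ (1−θ)⁴ N³`: use `|t| ≤ N` and `4Γ/25 ≤ N²`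
  have h1 : Γ * |t| ≤ 25 / 4 * N ^ 3 := by
    have : Γ ≤ 25 / 4 * N ^ 2 := by nlinarith [sq_nonneg t]
    nlinarith [this, htN, mul_nonneg (by positivity : (0:ℝ) ≤ 25 / 4 * N ^ 2) (sub_nonneg.2 htN)]
  have h2 : 48 * Γ * θ * |t| ≤ 300 * (θ * N ^ 3) := by
    have := mul_le_mul_of_nonneg_left h1 (by positivity : (0:ℝ) ≤ 48 * θ)
    linarith only [this]
  have h3 : (300 : ℝ) ≤ 303 * (1 - θ) ^ 4 := by norm_num at hc4; linarith only [hc4]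
  have h4 := mul_le_mul_of_nonneg_right h3 (by positivity : (0:ℝ) ≤ θ * N ^ 3)
  linarith only [h2, h4]

/-- Numeric bound, Term D3 (the line gradient times the tangent error): `(Γ/π)·(8π(N₁ + 0)/(1·N₁³))·θ ≤ 50θ`
(`N₁² = 4Γ/25 + t²`). [folklore] -/
theorem termD3_bound {Γ θ t N : ℝ} (hΓ : 0 < Γ) (hθ0 : 0 ≤ θ) (hN : N ^ 2 = 4 * Γ / 25 + t ^ 2) (hN0 : 0 ≤ N) :
    Γ * 4 / (4 * Real.pi) * (8 * Real.pi * (N + 0) / (1 * N ^ 3)) * θ ≤ 50 * θ := by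
  have hNpos : 0 < N := by nlinarith [sq_nonneg t]
  have heq : Γ * 4 / (4 * Real.pi) * (8 * Real.pi * (N + 0) / (1 * N ^ 3)) * θ = 8 * Γ * θ / N ^ 2 := by
    have hπ : Real.pi ≠ 0 := Real.pi_pos.ne'
    have hNne : N ≠ 0 := hNpos.ne'
    field_simp
    ring
  rw [heq, div_le_iff₀ (by positivity)]
  nlinarith [sq_nonneg t, hθ0, mul_nonneg hθ0 (sq_nonneg t)]

end SelectionBoxRJRung

end Summit.NavierStokesRegularity.NavierStokesRegularity.Theorems
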